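import Summits.Ventures.PercRepro.C025ProfileGirthRowSuccAll

/-!
# THE HALL FORM OF THE ROW `(q, q+1)` AT GIRTH `≥ q + 1` — PART A: THE STRUCTURE OF A RANK-`(q+1)` SET (night-3 g18)

Towards a per-pair certificate (`hallIneq_of_cert`) for the row `(q, q+1)` when every `q`-subset is independent:
* `mem_closure_iff_rkN_insert` — for `x ∈ E`, `x ∈ cl(B)` iff adding `x` does not raise the rank;
* `closure_eq_of_subset_of_rkN_eq` — a rank-preserving superset has the same closure (hence the same `N`, `m`);
* **`apex_unique`** — a rank-`(q+1)` set `S` of at least `q + 2` points has at most one APEX, a point `y` with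
  `ρ(S ∖ y) = q` (two apexes `y ≠ y'` give the rank-`q` sets `S ∖ y ≠ S ∖ y'` with `S ∖ y ∪ {y} = S ∖ y' ∪ {y'}`,
  against `insert_ne_insert_of_ne`);
* `apex_of_insert`, `rkN_erase_of_ne_apex`, `filters_eq_of_subset_of_rkN_eq` — the loaders of `S` live under its apex.
No `def`, no `instance`, no notation.  Axioms: standard.
-/

open scoped Matroid

namespace PercRepro

open Set Finset ThmH Staged

namespace GirthRows

variable {α : Type} [DecidableEq α] {M : Matroid α} [M.Finite]

open scoped Classical

/-- For a point `x` of the ground set, `x ∈ cl(B)` iff `ρ(B ∪ {x}) = ρ(B)`. -/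
theorem mem_closure_iff_rkN_insert {B : Finset α} (hBg : B ⊆ gr M) {x : α} (hx : x ∈ gr M) :
    x ∈ M.closure (B : Set α) ↔ rkN M (insert x B) = rkN M B := by
  constructor
  · intro h
    have hBE : (B : Set α) ⊆ M.E := by rw [← coe_gr]; exact_mod_cast hBg
    exact ThinGirth.rkN_insert_eq_of_mem_closure hBE h
  · intro h
    by_contra hc
    have := rkN_insert_of_notMem_closure (M := M) hx hc
    omega

/-- A superset of the same rank has the same closure. -/
theorem closure_eq_of_subset_of_rkN_eq {B X : Finset α} (hXg : X ⊆ gr M) (hBX : B ⊆ X)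
    (hr : rkN M X = rkN M B) : M.closure (X : Set α) = M.closure (B : Set α) := by
  have hBg : B ⊆ gr M := hBX.trans hXg
  apply subset_antisymm
  · apply Matroid.closure_subset_closure_of_subset_closure
    intro x hxX
    have hxg : x ∈ gr M := hXg (Finset.mem_coe.1 hxX)
    rw [mem_closure_iff_rkN_insert hBg hxg]
    have h1 : rkN M (insert x B) ≤ rkN M X :=
      Staged.rkN_mono (Finset.insert_subset (Finset.mem_coe.1 hxX) hBX)
    have h2 : rkN M B ≤ rkN M (insert x B) := Staged.rkN_mono (Finset.subset_insert x B)
    omega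
  · exact M.closure_subset_closure (Finset.coe_subset.2 hBX)

/-- The two closure-filters of a rank-preserving superset agree. -/
theorem filters_eq_of_subset_of_rkN_eq {B X : Finset α} (hXg : X ⊆ gr M) (hBX : B ⊆ X)
    (hr : rkN M X = rkN M B) :
    (gr M).filter (fun x => x ∈ M.closure (X : Set α)) = (gr M).filter (fun x => x ∈ M.closure (B : Set α)) ∧
    (gr M).filter (fun x => x ∉ M.closure (X : Set α)) = (gr M).filter (fun x => x ∉ M.closure (B : Set α)) := by
  rw [closure_eq_of_subset_of_rkN_eq hXg hBX hr]
  exact ⟨rfl, rfl⟩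

/-- **At most one apex**: if `S ⊆ E` has rank `q + 1` and at least `q + 2` points, and `y, y' ∈ S` both satisfy
`ρ(S ∖ y) = q = ρ(S ∖ y')`, then `y = y'`. -/
theorem apex_unique {q : ℕ} (hg : ∀ T ⊆ M.E, T.encard ≤ q → M.Indep T) {S : Finset α} (hSg : S ⊆ gr M)
    (hSr : rkN M S = q + 1) (hSc : q + 2 ≤ S.card) {y y' : α} (hy : y ∈ S) (hy' : y' ∈ S)
    (hry : rkN M (S.erase y) = q) (hry' : rkN M (S.erase y') = q) : y = y' := by
  by_contra hne
  have hB : S.erase y ∈ Profile.Rq M q := by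
    rw [Profile.mem_Rq]
    exact ⟨(Finset.erase_subset y S).trans hSg, Staged.rkN_eq_iff.1 hry⟩
  have hB' : S.erase y' ∈ Profile.Rq M q := by
    rw [Profile.mem_Rq]
    exact ⟨(Finset.erase_subset y' S).trans hSg, Staged.rkN_eq_iff.1 hry'⟩
  have hcy : (S.erase y).card = S.card - 1 := Finset.card_erase_of_mem hy
  have hcy' : (S.erase y').card = S.card - 1 := Finset.card_erase_of_mem hy'
  have hneB : S.erase y ≠ S.erase y' := by
    intro h
    apply hne
    have h1 : y ∉ S.erase y' := by
      rw [← h]; exact Finset.notMem_erase y S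
    by_contra hne'
    exact h1 (Finset.mem_erase.2 ⟨hne', hy⟩)
  have hout : ∀ z ∈ S, rkN M (S.erase z) = q → z ∈ (gr M).filter (fun x => x ∉ M.closure ((S.erase z : Finset α) : Set α)) := by
    intro z hz hrz
    rw [Finset.mem_filter]
    refine ⟨hSg hz, ?_⟩
    rw [mem_closure_iff_rkN_insert ((Finset.erase_subset z S).trans hSg) (hSg hz), Finset.insert_erase hz, hSr, hrz]
    omega
  have := insert_ne_insert_of_ne hg hB hB' (by omega) (by omega) hneB (hout y hy hry) (hout y' hy' hry')
  apply this
  rw [Finset.insert_erase hy, Finset.insert_erase hy']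

/-- If `B ⊆ S`, `ρ(B) = q`, `ρ(S) = q + 1` and `S = B ∪ {y}` (`y ∉ B`), then `y` is an apex of `S` and `y ∉ cl(B)`. -/
theorem apex_of_insert {q : ℕ} {B : Finset α} (hBg : B ⊆ gr M) (hBr : rkN M B = q) {y : α} (hyg : y ∈ gr M)
    (hyB : y ∉ B) (hS : rkN M (insert y B) = q + 1) :
    rkN M ((insert y B).erase y) = q ∧ y ∉ M.closure (B : Set α) := by
  refine ⟨by rw [Finset.erase_insert hyB]; exact hBr, ?_⟩
  rw [mem_closure_iff_rkN_insert hBg hyg]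
  omega

/-- In a rank-`(q+1)` set `S` with apex `y` and at least `q + 2` points, every other point `z` satisfies
`ρ(S ∖ z) = q + 1`. -/
theorem rkN_erase_of_ne_apex {q : ℕ} (hg : ∀ T ⊆ M.E, T.encard ≤ q → M.Indep T) {S : Finset α} (hSg : S ⊆ gr M)
    (hSr : rkN M S = q + 1) (hSc : q + 2 ≤ S.card) {y : α} (hy : y ∈ S) (hry : rkN M (S.erase y) = q)
    {z : α} (hz : z ∈ S) (hzy : z ≠ y) : rkN M (S.erase z) = q + 1 := by
  have h1 : rkN M (S.erase z) ≤ rkN M S := Staged.rkN_mono (Finset.erase_subset z S)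
  have h2 : rkN M S ≤ rkN M (S.erase z) + 1 := by
    have := Staged.rkN_insert_le (M := M) (X := S.erase z) z
    rw [Finset.insert_erase hz] at this
    exact this
  rcases Nat.lt_or_ge (rkN M (S.erase z)) (q + 1) with hlt | hge
  · exfalso
    have hrz : rkN M (S.erase z) = q := by omega
    exact hzy (apex_unique hg hSg hSr hSc hz hy hrz hry)
  · omega

end GirthRows

end PercRepro
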